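import Summits.CriticalPhenomena.PercolationContinuityZ3.Theorems.Transplant.KNLevelsDefs
import Literature.Probability.Percolation.KozmaNitzanHittable
import HarnessLib

/-!
# F7 (generic), part 1 — the subbox / finite-support toolkit of `L/KozmaNitzanHittable.lean` over the weighting layer of ANY locally finite graph
# (`KNLevels.lattW G p`, `KNLevels.IsSubbox G W p D`, `KNLevels.FinSupp W S` of p3-g2's `KNLevelsDefs.lean`)

builds on p205010 (kernel theorem, internal audit signed; external expert review pending) — nothing in this file uses p205010.
Lane `prim-bschramm`, seat `prim-bschramm-stmt` (task F7, lead 07:32Z: "KozmaNitzanHittable + KozmaNitzanHGluing GENERIC OVER LEVELS on p3-g2's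
KNLevelsDefs"); helper file (`--supports stmt-CriticalPhenomena-4575`).

READING OF THE ORIGINAL (`L/KozmaNitzanHittable.lean`, 473 lines): its §§ "Unions of connection events", "Restricted weightings" (`restrW` and its
API), "Wiring with a target set" (`prodBernoulli_wireW_real_biUnion_openConn`) are ALREADY stated for an arbitrary (countable) vertex type and are
imported, not re-typed.  The `ℤ^d`-specific part is (a) the subbox/finite-support lemmas for KN's `IsSubbox (W) p (D : Finset (Site d))` — re-typed
HERE for the three-field `KNLevels.IsSubbox G` (adjacent pairs / non-adjacent pairs / exterior pairs) — and (b) the quarter-face geometry `qfGeom` +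
`isHittable_qfGeom` (KN Lemma 9), which is the SKELETON-specific linked-face input (BLUEPRINT-I-PHI Φ3/Φ8) and waits for p3-g2's generic
`Geom`/`IsHittable` shape (part 2).

* `KNLevels.isSubbox_lattW` — every finite vertex set is a subbox of the graph weighting `lattW G p`;
* `KNLevels.IsSubbox.restrW` (restriction to `S ⊇ D`), `.pinW` (pinning pairs disjoint from `D`), `.wireW` (wiring a set disjoint from `D`) —
  exactly as in the original (KN pp. 17, 22, 24, 28);
* `KNLevels.finSupp_restrW`, `KNLevels.finSupp_wireW_restrW`, `KNLevels.FinSupp.mono`, `KNLevels.FinSupp.pinW`, `KNLevels.finSupp_isSubbox_restrW_lattW`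
  — finite support of restricted / wired / pinned weightings on any vertex type.
[cite: KozmaNitzan2024, §4 p. 17 (subbox), p. 22 (wiring the cube), p. 24 (the subgraph A), p. 28 (conditioning away from D)]
-/

noncomputable section

namespace Summit.CriticalPhenomena.PercolationContinuityZ3.Theorems

namespace Transplant

namespace KNLevels

open Literature.Probability.Percolation Literature.Probability.LatticeModels SimpleGraph

variable {V : Type*} [DecidableEq V] {G : SimpleGraph V} [G.LocallyFinite]

/-! ## Subboxes of the graph weighting, of restricted, pinned and wired weightings -/

variable (G) in
/-- **Every finite vertex set is a subbox of the graph weighting** `lattW G p` (generalises `KozmaNitzan.isSubbox_lattW`).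
[cite: KozmaNitzan2024, §4 p. 17 (subbox)] -/
theorem isSubbox_lattW (p : unitInterval) (D : Finset V) : IsSubbox G (lattW G p) p D :=
  ⟨fun _ _ _ _ h => lattW_mk_of_adj G p h, fun _ _ _ _ _ h => lattW_mk_of_not_adj G p h,
    fun _ hvD hv x hx => lattW_mk_of_not_adj G p fun hadj => hv (mem_innerBoundary_iff.2 ⟨hvD, x, hx, hadj.symm⟩)⟩

omit [DecidableEq V] [G.LocallyFinite] in
/-- A weight bounded above by `0` is `0`. [folklore] -/
theorem eq_zero_of_le_zero {w : unitInterval} (h : w ≤ 0) : w = 0 := le_antisymm h bot_le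

/-- **Restriction to a set containing `D` preserves subboxes** (generalises `KozmaNitzan.IsSubbox.restrW`; KN p. 24 "we apply lemma 10 … in
the subgraph A"). [cite: KozmaNitzan2024, §4 p. 17 (subbox), p. 24] -/
theorem IsSubbox.restrW {W : Sym2 V → unitInterval} {p : unitInterval} {D : Finset V} (h : IsSubbox G W p D)
    {S : Set V} (hDS : (↑D : Set V) ⊆ S) : IsSubbox G (Literature.Probability.Percolation.restrW S W) p D := by
  refine ⟨fun u hu v hv huv => ?_, fun u hu v hv hne hadj => ?_, fun v hvD hv x hx => ?_⟩
  · rw [restrW_apply_of_mem W (mk_mem_wireSet_iff.2 ⟨hDS (Finset.mem_coe.2 hu), hDS (Finset.mem_coe.2 hv), huv.ne⟩)]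
    exact h.adj u hu v hv huv
  · have hle := restrW_le S W s(u, v)
    rw [h.nadj u hu v hv hne hadj] at hle
    exact eq_zero_of_le_zero hle
  · have hle := restrW_le S W s(x, v)
    rw [h.outside v hvD hv x hx] at hle
    exact eq_zero_of_le_zero hle

/-- **Pinning pairs none of whose endpoints lies in `D` preserves subboxes** (generalises `KozmaNitzan.IsSubbox.pinW`; KN p. 28: conditioning
on `ω|_{E_i}` away from the subbox). [cite: KozmaNitzan2024, §4 p. 17 (subbox), p. 28] -/
theorem IsSubbox.pinW {W : Sym2 V → unitInterval} {p : unitInterval} {D : Finset V} (h : IsSubbox G W p D)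
    {F : Set (Sym2 V)} (ξ : Set (Sym2 V)) (hF : ∀ e ∈ F, ∀ x ∈ e, x ∉ D) :
    IsSubbox G (Literature.Probability.Percolation.pinW W F ξ) p D := by
  refine ⟨fun u hu v hv huv => ?_, fun u hu v hv hne hadj => ?_, fun v hvD hv x hx => ?_⟩
  · rw [pinW_apply_of_not_mem _ _ (fun he => hF _ he u (Sym2.mem_mk_left u v) hu)]
    exact h.adj u hu v hv huv
  · rw [pinW_apply_of_not_mem _ _ (fun he => hF _ he u (Sym2.mem_mk_left u v) hu)]
    exact h.nadj u hu v hv hne hadj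
  · rw [pinW_apply_of_not_mem _ _ (fun he => hF _ he v (Sym2.mem_mk_right x v) hvD)]
    exact h.outside v hvD hv x hx

/-- **Wiring a set of vertices disjoint from `D` preserves subboxes** (generalises `KozmaNitzan.IsSubbox.wireW`; KN p. 22: the cube identified
to a point lies outside `D`). [cite: KozmaNitzan2024, §4 p. 17 (subbox), p. 22] -/
theorem IsSubbox.wireW {W : Sym2 V → unitInterval} {p : unitInterval} {D : Finset V} (h : IsSubbox G W p D)
    {C : Set V} (hCD : ∀ x ∈ C, x ∉ D) : IsSubbox G (Literature.Probability.Percolation.wireW C W) p D := by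
  refine ⟨fun u hu v hv huv => ?_, fun u hu v hv hne hadj => ?_, fun v hvD hv x hx => ?_⟩
  · rw [wireW_apply_of_not_mem _ (fun he => hCD u ((mk_mem_wireSet_iff.1 he).1) hu)]
    exact h.adj u hu v hv huv
  · rw [wireW_apply_of_not_mem _ (fun he => hCD u ((mk_mem_wireSet_iff.1 he).1) hu)]
    exact h.nadj u hu v hv hne hadj
  · rw [wireW_apply_of_not_mem _ (fun he => hCD v ((mk_mem_wireSet_iff.1 he).2.1) hvD)]
    exact h.outside v hvD hv x hx

/-! ## Finite support -/

omit [DecidableEq V] [G.LocallyFinite] in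
/-- Finite support is monotone in the support set. [folklore] -/
theorem FinSupp.mono {W : Sym2 V → unitInterval} {S S' : Finset V} (h : FinSupp W S) (hSS' : S ⊆ S') : FinSupp W S' :=
  ⟨fun e ⟨x, hx, hxS'⟩ => h.zero e ⟨x, hx, fun hxS => hxS' (hSS' hxS)⟩⟩

omit [DecidableEq V] [G.LocallyFinite] in
/-- **The restricted weighting is finitely supported on the restriction set** (generalises `finSupp_restrW` from `Site d`).
[cite: KozmaNitzan2024, Conjecture 1 (p. 3)] -/
theorem finSupp_restrW (S : Finset V) (w : Sym2 V → unitInterval) :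
    FinSupp (Literature.Probability.Percolation.restrW (↑S : Set V) w) S := by
  refine ⟨fun e he => restrW_apply_of_not_mem w fun h => ?_⟩
  obtain ⟨x, hx, hxS⟩ := he
  exact hxS (Finset.mem_coe.1 (h.1 x hx))

omit [DecidableEq V] [G.LocallyFinite] in
/-- A wired, restricted weighting is finitely supported on the restriction set when the wired set lies inside it (generalises
`KozmaNitzan.finSupp_wireW_restrW`). [folklore] -/
theorem finSupp_wireW_restrW (S : Finset V) {C : Set V} (hC : C ⊆ ↑S) (w : Sym2 V → unitInterval) :
    FinSupp (Literature.Probability.Percolation.wireW C (Literature.Probability.Percolation.restrW (↑S : Set V) w)) S := by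
  rw [← restrW_wireW_comm hC]
  exact finSupp_restrW S _

omit [DecidableEq V] [G.LocallyFinite] in
/-- Pinning pairs inside the support preserves finite support. [folklore] -/
theorem FinSupp.pinW {W : Sym2 V → unitInterval} {S : Finset V} (h : FinSupp W S) {F : Set (Sym2 V)} (ξ : Set (Sym2 V))
    (hF : F ⊆ wireSet (↑S : Set V)) : FinSupp (Literature.Probability.Percolation.pinW W F ξ) S := by
  refine ⟨fun e he => ?_⟩
  have heF : e ∉ F := by
    intro heF
    obtain ⟨x, hx, hxS⟩ := he
    exact hxS (Finset.mem_coe.1 ((hF heF).1 x hx))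
  rw [pinW_apply_of_not_mem _ _ heF]
  exact h.zero e he

/-- **The graph weighting restricted to a finite set `S ⊇ D` is a finitely supported weighting with subbox `D`** — the standard input pair
(`FinSupp`, `IsSubbox`) of the generic target lemma for percolation INSIDE a finite region (KN p. 22 the graph `Ω`, p. 24 the subgraph `A`).
[cite: KozmaNitzan2024, §4 p. 22, p. 24] -/
theorem finSupp_isSubbox_restrW_lattW (p : unitInterval) (S D : Finset V) (hDS : D ⊆ S) :
    FinSupp (Literature.Probability.Percolation.restrW (↑S : Set V) (lattW G p)) S ∧
      IsSubbox G (Literature.Probability.Percolation.restrW (↑S : Set V) (lattW G p)) p D :=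
  ⟨finSupp_restrW S _, (isSubbox_lattW G p D).restrW (Finset.coe_subset.2 hDS)⟩

end KNLevels

end Transplant

end Summit.CriticalPhenomena.PercolationContinuityZ3.Theorems
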